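/-
Copyright (c) 2026 the pub-hodgecm-mathlib formalisation cell (harness21).  Prover seat hodgecm-mathlib-K2E3-p23 (g3), Track B «K2-LIT» ∕ h413
(`stmt-HodgeConjecture-24833`), line `K2_E3_EllipticInputs`, 13a road A (line lead K2E3-p10 (g3)), item (D3) «Witt–Cartan, K₀-group currency, normalised
kernel», file G3a.  2026-09-04.
-/
import Summits.HodgeConjecture.HodgeConjecture.Theorems.K2E3WittCartanStep      -- G2 (this seat): the elimination step; brings G1 and ★ F1–F3
import HarnessLib

/-!
# Crux `H413` — K2-LIT E3 «EllipticInputs», 13a road A, item (D3) G3a: the Cartan decomposition of `U(σ, W)` (`W = wittFormOn e Han`, NORMALISED anisotropic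
# kernel, any `m`) — one-sided pivot, integrality of the kernel block, and TERMINATION of the frame induction (an integral `S_k`-block is absorbed into `K₀`)

Cell `hodgecm-mathlib`, Track B «K2-LIT», crux item `stmt-HodgeConjecture-24833` (h413), socket U12-g ‹13a› road A.  Item (D3) of RULINGS #13 (K2 bus 2026-09-04T02:16:29Z;
letter fixed 02:22:20Z): for `σ` an involution preserving `v`, a uniformiser `ϖ`, a standard indexing `e`, and `Han` hermitian, integral, normalised (`|h_an(z,z)| ≤ 1 → z ∈
𝒪^m`, ★ p856519), every `g ∈ U(σ, wittFormOn e Han)` is `k₁⁻¹ · diag(d) · k₂⁻¹` with `k₁, k₂ ∈ K₀ = U ∩ GL_N(𝒪)`, `σ(d_a) d_{rev a} = 1`, `d ≡ 1` on the kernel positions,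
`|d_a| = q^{−E_a}` with `E` ANTITONE along `Fin N`.  This is the `hrawW` binder of ★ p856772 `K2E3WittLeviCartanRecursionKernel.exists_leviIntegral_mul_diagonalGL_mul_kernel`
(K2E3-p10), the last letter of the 13a road at the non-quasi-split (`m = 2`) places.

THE PROOF is a frame induction INSIDE `U(σ, W)`: at stage `k ≤ r` the element `q = k₁ g k₂` has `e_a`, `f_a` (`a < k`) as eigenvectors with eigenvalues of valuation
`≤ B⁻¹ ≤ 1` on the `e`-side, sorted increasingly, and its entries and those of `q⁻¹` on the frame `S_k × S_k` are bounded by `B`.  If the `S_k`-block of `q` and `q⁻¹` is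
integral (always the case at `k = r`: the kernel block lies in `U(Han) ⊆ GL_m(𝒪)` by the normalisation) then `k₃ = q⁻¹ · diag(d) ∈ K₀` finishes (§2); otherwise the
maximum `M > 1` over `S_k × S_k` is attained at a hyperbolic pivot (★ G1) and the elimination step (★ G2) produces the next eigen-pair with `|c_k| = M⁻¹ ≥ B⁻¹` (§3).

* §1 `exists_pivot_witt` — ★ G1's pivot made one-sided (`(q⁻¹)_{st} ↔ q_{rev t, rev s}`); `mem_stdLattice_of_frame_kernel` (a vector supported on the kernel with
  `|h_W(v,v)| ≤ 1` is integral); `frame_r_integral` (at `k = r` the `S_r`-block of `q`, `q⁻¹` is integral); `diagonal_mulVec_eq_self_of_frame`.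
* §2 **`exists_cartan_of_integral_frame`** — TERMINATION: eigen-structure off `S_k` + integral `S_k`-block ⇒ `q · k₂ = diag(d)` with `k₂ ∈ K₀` and `d`, `E` as in the
  letter.  The induction itself and the letter `hrawW` are in G3b ★ `K2E3WittCartan`.

`--supports stmt-HodgeConjecture-24833 --as helper`.  THEOREMS ONLY — no `def`, no named fact, no instance, no notation, no `sorry`.  HONEST LABEL: HC_CM is
proved only modulo the 7 printed citations (2 remaining named inputs: hLiu418 = stmt-HodgeConjecture-24832, h413 = stmt-HodgeConjecture-24833) until rung 0
closes; unconditional local algebra, closes no organ by itself.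

References: [BruhatTits1972] F. Bruhat, J. Tits, Publ. Math. IHÉS 41 (1972), (4.4.3) (`G = K Λ⁺ K` for a good maximal compact `K`) · [Tits1979] J. Tits, PSPM 33.1
(1979), §3.3.3 · [Macdonald1995] I. G. Macdonald (1995), Ch. V §2 · [Jacobowitz1962] R. Jacobowitz, Amer. J. Math. 84 (1962), §§4, 7–10 · [Omeara1963] O. T.
O'Meara (1963), §91A.
-/

set_option autoImplicit false
-- the mandated namespace repeats `HodgeConjecture.HodgeConjecture`, as in every `Theorems/*.lean` of this sub-problem
set_option linter.dupNamespace false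

noncomputable section

open scoped Matrix MatrixGroups Valued WithZero
open Matrix

namespace Summit.HodgeConjecture.HodgeConjecture.Cruxes.H413.K2E3WittCartanTerminate

open Literature.NumberTheory.Automorphic Literature.NumberTheory.Automorphic.UnitaryGroup Literature.NumberTheory.Automorphic.HermitianLattice
open K2E3LocalUnitaryWitt K2E3WittCartanUnramified K2E3WittParabolicBlocks K2E3WittHermFormStd K2E3WittIntegralMoves K2E3WittIntegralTransitive K2E3WittIwasawa
  K2E3WittCartanPivot K2E3WittCartanStep

variable {K : Type*} [Field K] [Valued K ℤᵐ⁰] (σ : K →+* K) {N r m : ℕ} (e : WittIndex r m ≃ Fin N)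
  (hstd : ∀ x, (e x).val = Sum.elim (fun i : Fin r => i.val) (Sum.elim (fun u : Fin m => r + u.val) (fun j : Fin r => r + m + j.val)) x)
  (Han : Matrix (Fin m) (Fin m) K)

/-! ## §1 One-sided pivot; the kernel block at `k = r` is integral -/

section Tools

include hstd in
/-- **The pivot, one-sided**: under the hypotheses of ★ G1 `exists_hyperbolic_pivot`, but with the maximum `M` attained on `S × S` by `q` OR by `q⁻¹`, there is a
hyperbolic pivot `|q_{st}| = M`, `s, t ∈ S`, for `q` itself — a pivot `(s, t)` of `q⁻¹` is the pivot `(rev t, rev s)` of `q` (★ G1 `inv_apply_of_hyperbolic`).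
[cite: Macdonald1995, Ch. V §2] [cite: BruhatTits1972, (4.4.3)] -/
theorem exists_pivot_witt (hvσ : ∀ a, Valued.v (σ a) = Valued.v a) {ϖ : K} (hϖ : Valued.v ϖ = WithZero.exp (-1 : ℤ))
    (hint : ∀ u u', Valued.v (Han u u') ≤ 1) (hmax : ∀ z : Fin m → K, Valued.v (hermForm σ Han z z) ≤ 1 → z ∈ stdLattice K m)
    (q : unitaryGroupOfForm σ (wittFormOn e Han)) {S : Finset (Fin N)} (hS : ∀ i ∈ S, Fin.rev i ∈ S) (hSk : ∀ a : Fin N, r ≤ a.val → a.val < r + m → a ∈ S)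
    (hqS : ∀ b ∈ S, ((q : GL (Fin N) K) : Matrix (Fin N) (Fin N) K) *ᵥ Pi.single b 1 ∈ frame K N S)
    (hqiS : ∀ b ∈ S, (((q : GL (Fin N) K)⁻¹ : GL (Fin N) K) : Matrix (Fin N) (Fin N) K) *ᵥ Pi.single b 1 ∈ frame K N S)
    {M : ℤᵐ⁰} (hM1 : 1 < M)
    (hle : ∀ a ∈ S, ∀ b ∈ S, Valued.v (((q : GL (Fin N) K) : Matrix (Fin N) (Fin N) K) a b) ≤ M ∧
      Valued.v ((((q : GL (Fin N) K)⁻¹ : GL (Fin N) K) : Matrix (Fin N) (Fin N) K) a b) ≤ M)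
    {a₀ b₀ : Fin N} (hb₀ : b₀ ∈ S)
    (hab : Valued.v (((q : GL (Fin N) K) : Matrix (Fin N) (Fin N) K) a₀ b₀) = M ∨ Valued.v ((((q : GL (Fin N) K)⁻¹ : GL (Fin N) K) : Matrix (Fin N) (Fin N) K) a₀ b₀) = M) :
    ∃ s ∈ S, ∃ t ∈ S, (s.val < r ∨ r + m ≤ s.val) ∧ (t.val < r ∨ r + m ≤ t.val) ∧ Valued.v (((q : GL (Fin N) K) : Matrix (Fin N) (Fin N) K) s t) = M := by
  -- a pivot of `q⁻¹` is a pivot of `q`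
  have hconv : ∀ {s t : Fin N}, s ∈ S → t ∈ S → (s.val < r ∨ r + m ≤ s.val) → (t.val < r ∨ r + m ≤ t.val) →
      Valued.v ((((q : GL (Fin N) K)⁻¹ : GL (Fin N) K) : Matrix (Fin N) (Fin N) K) s t) = M →
      ∃ s ∈ S, ∃ t ∈ S, (s.val < r ∨ r + m ≤ s.val) ∧ (t.val < r ∨ r + m ≤ t.val) ∧ Valued.v (((q : GL (Fin N) K) : Matrix (Fin N) (Fin N) K) s t) = M :=
    fun {s t} hsS htS hs ht h => ⟨Fin.rev t, hS t htS, Fin.rev s, hS s hsS, rev_hyperbolic e ht, rev_hyperbolic e hs, by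
      rw [inv_apply_of_hyperbolic σ e hstd Han q hs ht, hvσ] at h; exact h⟩
  have hqi : ((((q⁻¹ : unitaryGroupOfForm σ (wittFormOn e Han)) : GL (Fin N) K)) : Matrix (Fin N) (Fin N) K) =
      (((q : GL (Fin N) K)⁻¹ : GL (Fin N) K) : Matrix (Fin N) (Fin N) K) := by rw [Subgroup.coe_inv]
  have hqii : (((((q⁻¹ : unitaryGroupOfForm σ (wittFormOn e Han)) : GL (Fin N) K))⁻¹ : GL (Fin N) K) : Matrix (Fin N) (Fin N) K) =
      ((q : GL (Fin N) K) : Matrix (Fin N) (Fin N) K) := by rw [Subgroup.coe_inv, inv_inv]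
  rcases hab with hab | hab
  · rcases exists_hyperbolic_pivot σ e hstd Han hvσ hϖ hint hmax q hS hSk hqS hqiS hM1 (fun a ha b hb => (hle a ha b hb).1) (fun a ha b hb => (hle a ha b hb).2) hb₀ hab
      with ⟨s, hsS, t, htS, hs, ht, h⟩ | ⟨s, hsS, t, htS, hs, ht, h⟩
    · exact ⟨s, hsS, t, htS, hs, ht, h⟩
    · exact hconv hsS htS hs ht h
  · rcases exists_hyperbolic_pivot σ e hstd Han hvσ hϖ hint hmax q⁻¹ hS hSk (fun b hb => by rw [hqi]; exact hqiS b hb) (fun b hb => by rw [hqii]; exact hqS b hb) hM1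
      (fun a ha b hb => by rw [hqi]; exact (hle a ha b hb).2) (fun a ha b hb => by rw [hqii]; exact (hle a ha b hb).1) hb₀ (by rw [hqi]; exact hab)
      with ⟨s, hsS, t, htS, hs, ht, h⟩ | ⟨s, hsS, t, htS, hs, ht, h⟩
    · rw [hqi] at h; exact hconv hsS htS hs ht h
    · rw [hqii] at h; exact ⟨s, hsS, t, htS, hs, ht, h⟩

include hstd in
/-- **A vector supported on the kernel positions with `|h_W(v,v)| ≤ 1` is integral** (the hyperbolic part of the split vanishes; `hmax`).
[cite: Omeara1963, §91A] [cite: Jacobowitz1962, §4] -/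
theorem mem_stdLattice_of_frame_kernel (hmax : ∀ z : Fin m → K, Valued.v (hermForm σ Han z z) ≤ 1 → z ∈ stdLattice K m) {v : Fin N → K}
    (hv0 : ∀ a : Fin N, (a.val < r ∨ r + m ≤ a.val) → v a = 0) (hv : Valued.v (hermForm σ (wittFormOn e Han) v v) ≤ 1) : v ∈ stdLattice K N := by
  have hsplit := hermForm_witt_eq_sum_add σ e hstd Han v v
  have hzero : (∑ i : Fin r, (σ (v (e (Sum.inl i))) * v (Fin.rev (e (Sum.inl i))) + σ (v (e (Sum.inr (Sum.inr i)))) * v (Fin.rev (e (Sum.inr (Sum.inr i)))))) = 0 :=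
    Finset.sum_eq_zero fun i _ => by
      rw [hv0 _ (apply_inl_hyperbolic e hstd i), hv0 _ (apply_inr_inr_hyperbolic e hstd i), map_zero, zero_mul, zero_mul, add_zero]
  rw [hzero, zero_add] at hsplit
  rw [hsplit] at hv
  have hmid := hmax _ hv
  intro a
  by_cases ha : a.val < r ∨ r + m ≤ a.val
  · rw [hv0 a ha, map_zero]; exact zero_le
  · have h₁ : r ≤ a.val := by omega
    have h₂ : a.val < r + m := by omega
    have h := hmid ⟨a.val - r, by omega⟩
    dsimp only at h
    rwa [← eq_apply_inr_inl_of e hstd h₁ h₂] at h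

include hstd in
/-- **At `k = r` the `S_r`-block (= the kernel block) of `q` and of `q⁻¹` is integral**, for `q ∈ U(σ, W)` having every `e_a`, `a ∉ S_r`, as an eigenvector: the columns
`q e_b`, `b` a kernel position, are supported on the kernel and have norm `|Han_bb| ≤ 1`. [cite: Omeara1963, §91A] [cite: BruhatTits1972, (4.4.3)] -/
theorem frame_r_integral (hint : ∀ u u', Valued.v (Han u u') ≤ 1) (hmax : ∀ z : Fin m → K, Valued.v (hermForm σ Han z z) ≤ 1 → z ∈ stdLattice K m)
    (q : unitaryGroupOfForm σ (wittFormOn e Han))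
    (heig : ∀ a : Fin N, a ∉ (Finset.univ.filter fun a : Fin N => r ≤ a.val ∧ a.val + r < N) →
      ∃ c : K, ((q : GL (Fin N) K) : Matrix (Fin N) (Fin N) K) *ᵥ Pi.single a 1 = c • Pi.single a 1) :
    ∀ a ∈ (Finset.univ.filter fun a : Fin N => r ≤ a.val ∧ a.val + r < N), ∀ b ∈ (Finset.univ.filter fun a : Fin N => r ≤ a.val ∧ a.val + r < N),
      Valued.v (((q : GL (Fin N) K) : Matrix (Fin N) (Fin N) K) a b) ≤ 1 ∧ Valued.v ((((q : GL (Fin N) K)⁻¹ : GL (Fin N) K) : Matrix (Fin N) (Fin N) K) a b) ≤ 1 := by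
  have hN : N = r + (m + r) := card_eq e
  set S : Finset (Fin N) := Finset.univ.filter fun a : Fin N => r ≤ a.val ∧ a.val + r < N with hSdef
  have hS : ∀ i ∈ S, Fin.rev i ∈ S := rev_mem_frameSet r
  have hSc : ∀ a : Fin N, a ∉ S → (a.val < r ∨ r + m ≤ a.val) := hyperbolic_of_not_mem_frameSet e le_rfl
  have hhypS : ∀ a : Fin N, (a.val < r ∨ r + m ≤ a.val) → a ∉ S := fun a ha h => by rw [hSdef, mem_frameSet_iff] at h; omega
  have hcol : ∀ (g : unitaryGroupOfForm σ (wittFormOn e Han)), (∀ v ∈ frame K N S, ((g : GL (Fin N) K) : Matrix (Fin N) (Fin N) K) *ᵥ v ∈ frame K N S) →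
      ∀ a ∈ S, ∀ b ∈ S, Valued.v (((g : GL (Fin N) K) : Matrix (Fin N) (Fin N) K) a b) ≤ 1 := fun g hgS a _ b hb => by
    have hmem : ((g : GL (Fin N) K) : Matrix (Fin N) (Fin N) K) *ᵥ Pi.single b 1 ∈ stdLattice K N := by
      refine mem_stdLattice_of_frame_kernel σ e hstd Han hmax (fun a ha => hgS _ (single_mem_frame hb) a (hhypS a ha)) ?_
      rw [hermForm_mulVec_mulVec, hermForm_single_single]
      exact v_wittFormOn_apply_le_one e Han hint b b
    rw [apply_eq_mulVec_single ((g : GL (Fin N) K) : Matrix (Fin N) (Fin N) K) a b]; exact hmem a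
  intro a ha b hb
  refine ⟨hcol q (fun v hv => mulVec_mem_frame_of_eigen σ e hstd Han q hS hSc heig hv) a ha b hb, ?_⟩
  have h := hcol q⁻¹ (fun v hv => by
    have h' := mulVec_mem_frame_of_eigen σ e hstd Han q⁻¹ hS hSc (fun a' ha' => by
      obtain ⟨c, hc⟩ := heig a' ha'; rw [Subgroup.coe_inv]; exact ⟨c⁻¹, inv_mulVec_single_of_eigen σ q hc⟩) hv
    exact h') a ha b hb
  rwa [Subgroup.coe_inv] at h

omit [Valued K ℤᵐ⁰] in
/-- A diagonal matrix with entries `1` on `S` fixes `K^S` pointwise. [folklore] -/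
theorem diagonal_mulVec_eq_self_of_frame {c : Fin N → K} {S : Finset (Fin N)} (hc : ∀ a ∈ S, c a = 1) {w : Fin N → K} (hw : w ∈ frame K N S) :
    Matrix.diagonal c *ᵥ w = w := by
  funext a
  rw [Matrix.mulVec_diagonal]
  by_cases ha : a ∈ S
  · rw [hc a ha, one_mul]
  · rw [hw a ha, mul_zero]

end Tools

/-! ## §2 Termination: an integral `S_k`-block is absorbed into `K₀` -/

section Terminate

include hstd in
/-- **TERMINATION.**  Let `q ∈ U(σ, W)` have every `e_a`, `a ∉ S_k` (`k ≤ r`), as an eigenvector (eigenvalue `q_{aa}`), with `|q_{aa}| ≤ 1` and sorted increasingly on the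
positions `a < k`, and let the `S_k × S_k` entries of `q` and `q⁻¹` be INTEGRAL.  Then `q · k₂ = diag(d)` for some `k₂ ∈ K₀`, with `d = q_{aa}` off `S_k` and `d = 1` on
`S_k`: `σ(d_a) d_{rev a} = 1` (unitarity on the hyperbolic pairs), `d ≡ 1` on the kernel, `|d_a| = q^{−E_a}` with `E` antitone (`≥ 0` on the `e`-side, `0` on `S_k`, `≤ 0`
mirrored on the `f`-side); `k₂ = q⁻¹ · diag(d)` has columns `e_a` (`a ∉ S_k`) and `q⁻¹ e_a ∈ 𝒪^N ∩ K^{S_k}` (`a ∈ S_k`). [cite: BruhatTits1972, (4.4.3)] [cite: Tits1979, §3.3.3] -/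
theorem exists_cartan_of_integral_frame (hvσ : ∀ a, Valued.v (σ a) = Valued.v a) {k : ℕ} (hk : k ≤ r) (q : unitaryGroupOfForm σ (wittFormOn e Han))
    (heig : ∀ a : Fin N, a ∉ (Finset.univ.filter fun a : Fin N => k ≤ a.val ∧ a.val + k < N) →
      ((q : GL (Fin N) K) : Matrix (Fin N) (Fin N) K) *ᵥ Pi.single a 1 = ((q : GL (Fin N) K) : Matrix (Fin N) (Fin N) K) a a • Pi.single a 1)
    (hle1 : ∀ a : Fin N, a.val < k → Valued.v (((q : GL (Fin N) K) : Matrix (Fin N) (Fin N) K) a a) ≤ 1)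
    (hsort : ∀ a b : Fin N, a.val < k → b.val < k → a ≤ b →
      Valued.v (((q : GL (Fin N) K) : Matrix (Fin N) (Fin N) K) a a) ≤ Valued.v (((q : GL (Fin N) K) : Matrix (Fin N) (Fin N) K) b b))
    (hintS : ∀ a ∈ (Finset.univ.filter fun a : Fin N => k ≤ a.val ∧ a.val + k < N), ∀ b ∈ (Finset.univ.filter fun a : Fin N => k ≤ a.val ∧ a.val + k < N),
      Valued.v (((q : GL (Fin N) K) : Matrix (Fin N) (Fin N) K) a b) ≤ 1 ∧ Valued.v ((((q : GL (Fin N) K)⁻¹ : GL (Fin N) K) : Matrix (Fin N) (Fin N) K) a b) ≤ 1) :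
    ∃ k₂ : unitaryGroupOfForm σ (wittFormOn e Han), k₂ ∈ unitaryInt σ (wittFormOn e Han) ∧ ∃ (d : Fin N → K) (E : Fin N → ℤ),
      (((q * k₂ : unitaryGroupOfForm σ (wittFormOn e Han)) : GL (Fin N) K) : Matrix (Fin N) (Fin N) K) = Matrix.diagonal d ∧
      (∀ i, σ (d i) * d (Fin.rev i) = 1) ∧ (∀ u : Fin m, d (e (Sum.inr (Sum.inl u))) = 1) ∧ (∀ a, Valued.v (d a) = WithZero.exp (-E a)) ∧
      (∀ a b : Fin N, a ≤ b → E b ≤ E a) := by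
  have hN : N = r + (m + r) := card_eq e
  set S : Finset (Fin N) := Finset.univ.filter fun a : Fin N => k ≤ a.val ∧ a.val + k < N with hSdef
  set A : Matrix (Fin N) (Fin N) K := ((q : GL (Fin N) K) : Matrix (Fin N) (Fin N) K) with hA
  have hS : ∀ i ∈ S, Fin.rev i ∈ S := rev_mem_frameSet k
  have hSc : ∀ a : Fin N, a ∉ S → (a.val < r ∨ r + m ≤ a.val) := hyperbolic_of_not_mem_frameSet e hk
  have hSk : ∀ a : Fin N, r ≤ a.val → a.val < r + m → a ∈ S := kernel_mem_frameSet e hk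
  have hmemS : ∀ a : Fin N, a ∈ S ↔ k ≤ a.val ∧ a.val + k < N := fun a => by rw [hSdef, mem_frameSet_iff]
  have hc0 : ∀ a : Fin N, a ∉ S → A a a ≠ 0 := fun a ha => eigen_ne_zero σ q (heig a ha)
  -- unitarity on the hyperbolic pairs off `S`: `σ(c_a) c_{rev a} = 1`
  have hnorm : ∀ a : Fin N, a ∉ S → σ (A a a) * A (Fin.rev a) (Fin.rev a) = 1 := fun a ha => by
    have hra : Fin.rev a ∉ S := fun h => ha (by rw [← Fin.rev_rev a]; exact hS _ h)
    have h := hermForm_mulVec_mulVec q (Pi.single a (1 : K)) (Pi.single (Fin.rev a) 1)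
    rw [heig a ha, heig (Fin.rev a) hra, hermForm_smul_left_eq, hermForm_smul_right, hermForm_witt_single_left σ e hstd Han (hSc a ha),
      Pi.single_eq_same, mul_one] at h
    exact h
  have hvv : ∀ a : Fin N, a ∉ S → Valued.v (A a a) * Valued.v (A (Fin.rev a) (Fin.rev a)) = 1 := fun a ha => by
    rw [← hvσ (A a a), ← map_mul, hnorm a ha, map_one]
  -- the diagonal `d`
  obtain ⟨du, hdu⟩ : ∃ du : Fin N → Kˣ, du = fun a => if ha : a ∈ S then 1 else Units.mk0 (A a a) (hc0 a ha) := ⟨_, rfl⟩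
  have hduS : ∀ a, a ∈ S → (du a : K) = 1 := fun a ha => by rw [hdu]; dsimp only; rw [dif_pos ha, Units.val_one]
  have hdunS : ∀ a, a ∉ S → (du a : K) = A a a := fun a ha => by rw [hdu]; dsimp only; rw [dif_neg ha, Units.val_mk0]
  have hDU : glDiagonal N K du ∈ unitaryGroupOfForm σ (wittFormOn e Han) := by
    refine glDiagonal_mem_unitaryGroupOfForm σ _ du fun a b hab => ?_
    rcases eq_rev_or_kernel_of_wittFormOn_ne_zero e hstd Han hab with ⟨-, rfl⟩ | ⟨⟨ha₁, ha₂⟩, hb₁, hb₂⟩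
    · by_cases ha : a ∈ S
      · rw [hduS a ha, hduS _ (hS a ha), map_one, mul_one]
      · rw [hdunS a ha, hdunS _ (fun h => ha (by rw [← Fin.rev_rev a]; exact hS _ h)), hnorm a ha]
    · rw [hduS a (hSk a ha₁ ha₂), hduS b (hSk b hb₁ hb₂), map_one, mul_one]
  set D : unitaryGroupOfForm σ (wittFormOn e Han) := ⟨glDiagonal N K du, hDU⟩ with hD
  -- frame stability of `q`, `q⁻¹`
  have heig' : ∀ a : Fin N, a ∉ S → ∃ c : K, A *ᵥ Pi.single a 1 = c • Pi.single a 1 := fun a ha => ⟨_, heig a ha⟩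
  have hqS : ∀ {v : Fin N → K}, v ∈ frame K N S → A *ᵥ v ∈ frame K N S := fun hv => mulVec_mem_frame_of_eigen σ e hstd Han q hS hSc heig' hv
  have hqiS : ∀ {v : Fin N → K}, v ∈ frame K N S → (((q : GL (Fin N) K)⁻¹ : GL (Fin N) K) : Matrix (Fin N) (Fin N) K) *ᵥ v ∈ frame K N S := fun {v} hv => by
    have h := mulVec_mem_frame_of_eigen σ e hstd Han q⁻¹ hS hSc (fun a ha => by
      obtain ⟨c, hc⟩ := heig' a ha; rw [Subgroup.coe_inv]; exact ⟨c⁻¹, inv_mulVec_single_of_eigen σ q hc⟩) hv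
    rwa [Subgroup.coe_inv] at h
  -- `k₂ = q⁻¹ D ∈ K₀`
  refine ⟨q⁻¹ * D, mem_unitaryInt_of_columns (fun b => ?_) (fun b => ?_), fun a => (du a : K), fun a => -WithZero.log (Valued.v (du a : K)), ?_, ?_, ?_, ?_, ?_⟩
  · -- columns of `k₂`
    rw [mul_mulVec, hD]
    change (((q⁻¹ : unitaryGroupOfForm σ (wittFormOn e Han)) : GL (Fin N) K) : Matrix (Fin N) (Fin N) K) *ᵥ
      (((glDiagonal N K du : GL (Fin N) K) : Matrix (Fin N) (Fin N) K) *ᵥ Pi.single b 1) ∈ stdLattice K N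
    rw [glDiagonal_mulVec_single, Matrix.mulVec_smul, Subgroup.coe_inv]
    by_cases hb : b ∈ S
    · rw [hduS b hb, one_smul]
      exact fun a => v_apply_le_of_frame (hqiS (single_mem_frame hb)) (fun a ha => by rw [← apply_eq_mulVec_single]; exact (hintS a ha b hb).2) a
    · rw [inv_mulVec_single_of_eigen σ q (heig b hb), smul_smul, hdunS b hb, mul_inv_cancel₀ (hc0 b hb), one_smul]
      exact single_mem_stdLattice b
  · -- columns of `k₂⁻¹ = D⁻¹ q`
    rw [← Subgroup.coe_inv, _root_.mul_inv_rev, inv_inv, mul_mulVec, hD, Subgroup.coe_inv]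
    change ((((glDiagonal N K du : GL (Fin N) K))⁻¹ : GL (Fin N) K) : Matrix (Fin N) (Fin N) K) *ᵥ (A *ᵥ Pi.single b 1) ∈ stdLattice K N
    rw [← map_inv, coe_glDiagonal]
    by_cases hb : b ∈ S
    · rw [diagonal_mulVec_eq_self_of_frame (fun a ha => by rw [Pi.inv_apply, Units.val_inv_eq_inv_val, hduS a ha, inv_one]) (hqS (single_mem_frame hb))]
      exact fun a => v_apply_le_of_frame (hqS (single_mem_frame hb)) (fun a ha => by rw [← apply_eq_mulVec_single]; exact (hintS a ha b hb).1) a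
    · rw [heig b hb, Matrix.mulVec_smul, diagonal_mulVec_single_one, smul_smul, Pi.inv_apply, Units.val_inv_eq_inv_val, hdunS b hb, mul_inv_cancel₀ (hc0 b hb), one_smul]
      exact single_mem_stdLattice b
  · -- `q k₂ = D`
    rw [mul_inv_cancel_left, hD]; exact coe_glDiagonal N K du
  · -- torus relation
    intro a
    dsimp only
    by_cases ha : a ∈ S
    · rw [hduS a ha, hduS _ (hS a ha), map_one, mul_one]
    · rw [hdunS a ha, hdunS _ (fun h => ha (by rw [← Fin.rev_rev a]; exact hS _ h)), hnorm a ha]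
  · -- `d ≡ 1` on the kernel
    intro u
    dsimp only
    exact hduS _ (hSk _ (by rw [hstd]; simp) (by rw [hstd]; simp))
  · -- `|d_a| = exp (−E a)`
    intro a
    dsimp only
    rw [neg_neg, WithZero.exp_log ((Valuation.ne_zero_iff _).2 (du a).ne_zero)]
  · -- `E` antitone, i.e. `|d|` increasing along `Fin N`
    intro a b hab
    dsimp only
    have hda0 : Valued.v (du a : K) ≠ 0 := (Valuation.ne_zero_iff _).2 (du a).ne_zero
    have hdb0 : Valued.v (du b : K) ≠ 0 := (Valuation.ne_zero_iff _).2 (du b).ne_zero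
    rw [neg_le_neg_iff, WithZero.log_le_log hda0 hdb0]
    have hav := a.isLt; have hbv := b.isLt; have hab' := Fin.le_def.1 hab
    -- the three regions: `a < k` (value ≤ 1), `a ∈ S` (value 1), `a ≥ N − k` (value ≥ 1)
    have hlow : ∀ c : Fin N, c.val < k → Valued.v (du c : K) ≤ 1 := fun c hc => by
      rw [hdunS c (fun h => by rw [hmemS] at h; omega)]; exact hle1 c hc
    have hmid : ∀ c : Fin N, c ∈ S → Valued.v (du c : K) = 1 := fun c hc => by rw [hduS c hc, map_one]
    have hhigh : ∀ c : Fin N, N ≤ c.val + k → 1 ≤ Valued.v (du c : K) := fun c hc => by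
      have hcS : c ∉ S := fun h => by rw [hmemS] at h; omega
      have hrc : (Fin.rev c).val < k := by rw [Fin.val_rev]; omega
      have h1 := hvv (Fin.rev c) (fun h => hcS (by rw [← Fin.rev_rev c]; exact hS _ h))
      rw [Fin.rev_rev] at h1
      rw [hdunS c hcS]
      by_contra hlt
      rw [not_le] at hlt
      have h2 : Valued.v (A (Fin.rev c) (Fin.rev c)) * Valued.v (A c c) < 1 :=
        calc Valued.v (A (Fin.rev c) (Fin.rev c)) * Valued.v (A c c) ≤ 1 * Valued.v (A c c) := mul_le_mul' (hle1 _ hrc) le_rfl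
          _ = Valued.v (A c c) := one_mul _
          _ < 1 := hlt
      rw [h1] at h2; exact lt_irrefl _ h2
    by_cases hb : b.val < k
    · -- both low
      rw [hdunS a (fun h => by rw [hmemS] at h; omega), hdunS b (fun h => by rw [hmemS] at h; omega)]
      exact hsort a b (by omega) hb hab
    by_cases hbS : b ∈ S
    · rw [hmid b hbS]
      by_cases haS : a ∈ S
      · rw [hmid a haS]
      · exact hlow a (by rw [hmemS] at haS hbS; omega)
    · have hbhigh : N ≤ b.val + k := by rw [hmemS] at hbS; omega
      by_cases ha : a.val < k
      · exact (hlow a ha).trans (hhigh b hbhigh)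
      by_cases haS : a ∈ S
      · rw [hmid a haS]; exact hhigh b hbhigh
      · -- both high: mirror of the sorted low region
        have hahigh : N ≤ a.val + k := by rw [hmemS] at haS; omega
        have hra : (Fin.rev a).val < k := by rw [Fin.val_rev]; omega
        have hrb : (Fin.rev b).val < k := by rw [Fin.val_rev]; omega
        have h1 := hvv (Fin.rev a) (fun h => haS (by rw [← Fin.rev_rev a]; exact hS _ h))
        have h2 := hvv (Fin.rev b) (fun h => hbS (by rw [← Fin.rev_rev b]; exact hS _ h))
        rw [Fin.rev_rev] at h1 h2
        have h3 := hsort (Fin.rev b) (Fin.rev a) hrb hra (Fin.rev_le_rev.2 hab)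
        rw [hdunS a haS, hdunS b hbS]
        -- `x·u = 1`, `y·w = 1`, `y ≤ x` ⇒ `u ≤ w`
        have hx0 : Valued.v (A (Fin.rev a) (Fin.rev a)) ≠ 0 := fun h => by rw [h, zero_mul] at h1; exact zero_ne_one h1
        have hy0 : Valued.v (A (Fin.rev b) (Fin.rev b)) ≠ 0 := fun h => by rw [h, zero_mul] at h2; exact zero_ne_one h2
        rw [eq_inv_of_mul_eq_one_right h1, eq_inv_of_mul_eq_one_right h2]
        exact inv_anti₀ (zero_lt_iff.2 hy0) h3

end Terminate

end Summit.HodgeConjecture.HodgeConjecture.Cruxes.H413.K2E3WittCartanTerminate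

end
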